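import Literature.NumberTheory.Transcendental.KZFibredRelations

/-!
# `BetaCancellation` (stmt-KontsevichZagierPeriods-13633) — line `dirichlet-companion-to-pi`, stub `stub_fibredLeWall`

Helper file of the crux lead (`--supports` stmt-KontsevichZagierPeriods-13633), registered stub
`stub_fibredLeWall` of the reshaped skeleton (wall descent). The *wall-respecting generators* are:
all additivity moves, the changes of variables `Φ` on `(n+1)`-dimensional representations which
preserve pointwise the two open sides of the wall `z 0 = -1/2`
(`(Φ x 0 < -1/2 ↔ x 0 < -1/2) ∧ (-1/2 < Φ x 0 ↔ -1/2 < x 0)` on the domain), and the Newton–Leibniz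
moves over a base of dimension `≥ 1` (`KZ.fibredNewtonLeibnizRel`). A fibred change of variables
(`Φ x 0 = x 0` on the domain, `KZ.fibredChangeOfVariablesRel`) trivially preserves both sides, so
the fibred generators `KZ.fibredGenerators` are wall-respecting generators and, by monotonicity of
`AddSubgroup.closure`, `KZ.fibredRelations ≤` the closure of the wall-respecting generators.
Pure set/closure bookkeeping; no definitions are introduced.

References: M. Kontsevich, D. Zagier, *Periods* (2001), §1.2 (rules (1)–(3)).
-/

noncomputable section

-- `Summit.KontsevichZagierPeriods.KontsevichZagierPeriods.…` is the tree's mandated layout (single-conjunct summit).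
set_option linter.dupNamespace false

namespace Summit.KontsevichZagierPeriods.KontsevichZagierPeriods.BetaCancellationLine

open Set
open Literature.NumberTheory.Transcendental
open Literature.NumberTheory.Transcendental.KZ

/-- A fibred change of variables (`Φ x 0 = x 0` on the domain) is a wall-respecting change of
variables (both open sides of the wall `z 0 = -1/2` are preserved pointwise). [folklore] -/
theorem fibredLeWall_fibredChangeOfVariablesRel_subset :
    fibredChangeOfVariablesRel ⊆
      {x | ∃ (n : ℕ) (r r' : IntegralRep (n + 1)) (Φ : (Fin (n + 1) → ℝ) → (Fin (n + 1) → ℝ))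
          (Φ' : (Fin (n + 1) → ℝ) → (Fin (n + 1) → ℝ) →L[ℝ] (Fin (n + 1) → ℝ)),
        IsSemialgebraicMapOn ℚ r.domain Φ ∧
        (∀ x ∈ r.domain, HasFDerivWithinAt Φ (Φ' x) r.domain x) ∧ Set.InjOn Φ r.domain ∧
        r'.domain = Φ '' r.domain ∧
        (∀ x ∈ r.domain, r.integrand x = r'.integrand (Φ x) * |(Φ' x).det|) ∧
        (∀ x ∈ r.domain, (Φ x 0 < -1/2 ↔ x 0 < -1/2) ∧ (-1/2 < Φ x 0 ↔ -1/2 < x 0)) ∧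
        x = of r - of r'} := by
  rintro c ⟨n, r, r', Φ, Φ', hΦ, hΦ', hinj, hdom, hf, h0, rfl⟩
  exact ⟨n, r, r', Φ, Φ', hΦ, hΦ', hinj, hdom, hf,
    fun x hx => by rw [h0 x hx]; exact ⟨Iff.rfl, Iff.rfl⟩, rfl⟩

/-- The fibred generators are wall-respecting generators. [folklore] -/
theorem fibredLeWall_fibredGenerators_subset :
    fibredGenerators ⊆ domainAddRel ∪ integrandAddRel ∪
      {x | ∃ (n : ℕ) (r r' : IntegralRep (n + 1)) (Φ : (Fin (n + 1) → ℝ) → (Fin (n + 1) → ℝ))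
          (Φ' : (Fin (n + 1) → ℝ) → (Fin (n + 1) → ℝ) →L[ℝ] (Fin (n + 1) → ℝ)),
        IsSemialgebraicMapOn ℚ r.domain Φ ∧
        (∀ x ∈ r.domain, HasFDerivWithinAt Φ (Φ' x) r.domain x) ∧ Set.InjOn Φ r.domain ∧
        r'.domain = Φ '' r.domain ∧
        (∀ x ∈ r.domain, r.integrand x = r'.integrand (Φ x) * |(Φ' x).det|) ∧
        (∀ x ∈ r.domain, (Φ x 0 < -1/2 ↔ x 0 < -1/2) ∧ (-1/2 < Φ x 0 ↔ -1/2 < x 0)) ∧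
        x = of r - of r'} ∪
      fibredNewtonLeibnizRel := by
  rw [fibredGenerators_def]
  rintro c (((hc | hc) | hc) | hc)
  · exact Or.inl (Or.inl (Or.inl hc))
  · exact Or.inl (Or.inl (Or.inr hc))
  · exact Or.inl (Or.inr (fibredLeWall_fibredChangeOfVariablesRel_subset hc))
  · exact Or.inr hc

/-- STUB (monotonicity of the reshape): fibred relations are wall-respecting relations. [folklore] -/
theorem stub_fibredLeWall :
    fibredRelations ≤ AddSubgroup.closure (domainAddRel ∪ integrandAddRel ∪
          {x | ∃ (n : ℕ) (r r' : IntegralRep (n + 1)) (Φ : (Fin (n + 1) → ℝ) → (Fin (n + 1) → ℝ))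
              (Φ' : (Fin (n + 1) → ℝ) → (Fin (n + 1) → ℝ) →L[ℝ] (Fin (n + 1) → ℝ)),
            IsSemialgebraicMapOn ℚ r.domain Φ ∧
            (∀ x ∈ r.domain, HasFDerivWithinAt Φ (Φ' x) r.domain x) ∧ Set.InjOn Φ r.domain ∧
            r'.domain = Φ '' r.domain ∧
            (∀ x ∈ r.domain, r.integrand x = r'.integrand (Φ x) * |(Φ' x).det|) ∧
            (∀ x ∈ r.domain, (Φ x 0 < -1/2 ↔ x 0 < -1/2) ∧ (-1/2 < Φ x 0 ↔ -1/2 < x 0)) ∧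
            x = of r - of r'} ∪
          fibredNewtonLeibnizRel) := by
  rw [fibredRelations_def]
  exact AddSubgroup.closure_mono fibredLeWall_fibredGenerators_subset

end Summit.KontsevichZagierPeriods.KontsevichZagierPeriods.BetaCancellationLine
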